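import Summits.BirchSwinnertonDyer.BirchSwinnertonDyer.Theorems.ManinLocalTwoThreeBracketSturmEightyFourA
import HarnessLib

/-!
# Level 84 = 2²·3·7 (C2 domain, `4 ∥ 84`; TWO classes `84a`, `84b`) COMPLETE: `|c| = 1` — hence `2 ∤ c` — for EVERY lattice-optimal `X₀(84)`-datum of EVERY
# globally minimal elliptic curve over `ℚ`, UNCONDITIONALLY

Cell `bsd-f2-manin`, route `ManinLocalTwoThree`, crux C2 `ManinOddAtFour` (stmt-BirchSwinnertonDyer-22967: `2² ∣ 84`); prover seat p2 gen 31 (pack), `--supports` (helper).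
ASSEMBLY: an's FACT-FREE two-row kernel pinning `PinningEightyFour.pinning` (rows `84a`: `d′ = 836`, `84b`: `d′ = 1672`, on the `22`-quotient `η`-basis of
`M₂(Γ₀(84))`; landed by LEAD p1 g26) + DEEP tables (`…EtaTablesEightyFourDeep*`, depth `194 = μ₀ + 2`, staged dense certificates with pentagonal Euler tables)
+ the two Bracket–Sturm certificates `…BracketSturmEightyFourA/B` (`84a1 = [0,1,0,7,0]`, `84b1 = [0,−1,0,−1,−2]`; one defect decide each; Sturm `192 < 194`):
**`|c| = 1` and `2 ∤ c` on `X₀(84)`**.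
HONEST FRAMING: unconditional (standard axioms); ONE level of C2 — nothing here proves C2 for all `N`, Manin's conjecture or BSD; item 22967 stays OPEN.
[cite: Manin1972, Prop. 1.4] [cite: Sturm1987, Thm. 1] [cite: AgasheRibetStein2006, §§1–2] [cite: CremonaAlgorithms1997, §2.10, Table 1 (84a1, 84b1), Table 3 (N = 84)]
[cite: Koehler2011, §2.1]
-/

set_option autoImplicit false
-- lint-debt: the directory name repeats the summit name (sibling precedent `ManinLocalTwoThreeManinConstantEightyEight.lean`)
set_option linter.dupNamespace false

noncomputable section

open Complex
open UpperHalfPlane hiding I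
open scoped MatrixGroups ModularForm
open ModularForm CongruenceSubgroup PowerSeries
open Literature.NumberTheory.ModularForms
open Literature.NumberTheory.EllipticCurves Literature.NumberTheory.EllipticCurves.ModularForms

namespace Summit.BirchSwinnertonDyer.BirchSwinnertonDyer.Theorems.ManinLocalTwoThree.LevelEightyFour

open Summit.BirchSwinnertonDyer.BirchSwinnertonDyer.Theorems.ManinLocalTwoThree.BracketSturm Summit.BirchSwinnertonDyer.BirchSwinnertonDyer.Theorems.ManinLocalTwoThree.PinningKernel Summit.BirchSwinnertonDyer.BirchSwinnertonDyer.Theorems.ManinLocalTwoThree.PinningEightyFour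

/-- **`|c| = 1` FOR EVERY LATTICE-OPTIMAL `X₀(84)`-DATUM of every globally minimal elliptic curve over `ℚ`** — UNCONDITIONAL (both pinning rows).
[cite: Manin1972, Prop. 1.4] [cite: AgasheRibetStein2006, §§1–2] [cite: CremonaAlgorithms1997, Table 1 (84a1, 84b1)] -/
theorem abs_maninConstant_eq_one_eightyFour (W : WeierstrassCurve ℚ) [W.IsElliptic] [W.IsGloballyMinimal]
    (D : ModularParametrizationData W 84) (hopt : ∀ z ∈ D.L.lattice, ∃ w ∈ periodLattice D.f, z = D.c * w) :
    |D.maninConstant| = 1 := by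
  obtain ⟨C, hC, c, hc, -, hpin⟩ := pinning D
  rw [show goodCerts = [rowB, rowA] from rfl] at hc
  simp only [List.mem_cons, List.mem_nil_iff, or_false] at hc
  rcases hc with rfl | rfl
  · exact abs_maninConstant_eq_one_eightyFourB_of_row W D hopt C hC hpin
  · exact abs_maninConstant_eq_one_eightyFourA_of_row W D hopt C hC hpin

/-- **C2 `ManinOddAtFour` at `N = 84` (`2² ∣ 84`): `2 ∤ c(D)`** for every lattice-optimal `X₀(84)`-datum — UNCONDITIONAL. [cite: AgasheRibetStein2006, §§1–2] -/
theorem not_two_dvd_maninConstant_eightyFour (W : WeierstrassCurve ℚ) [W.IsElliptic] [W.IsGloballyMinimal]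
    (D : ModularParametrizationData W 84) (hopt : ∀ z ∈ D.L.lattice, ∃ w ∈ periodLattice D.f, z = D.c * w) :
    ¬ (2 : ℤ) ∣ D.maninConstant := by
  have h := abs_maninConstant_eq_one_eightyFour W D hopt
  intro h2
  have := Int.le_of_dvd (by rw [h]; norm_num) ((dvd_abs _ _).mpr h2)
  rw [h] at this
  norm_num at this

/-- **The C2 conclusion on the whole `X₀(84)`-domain**: `2² ∣ 84`, and `|c| = 1 ∧ 2 ∤ c` for every lattice-optimal `X₀(84)`-datum of every globally minimal
elliptic curve over `ℚ` — UNCONDITIONAL; BSD and C2 for general `N` are NOT proved by this. [folklore] -/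
theorem maninOddAtFour_eightyFour :
    2 ^ 2 ∣ 84 ∧ ∀ (W : WeierstrassCurve ℚ) [W.IsElliptic] [W.IsGloballyMinimal] (D : ModularParametrizationData W 84),
      (∀ z ∈ D.L.lattice, ∃ w ∈ periodLattice D.f, z = D.c * w) → |D.maninConstant| = 1 ∧ ¬ (2 : ℤ) ∣ D.maninConstant :=
  ⟨⟨21, by norm_num⟩, fun W _ _ D hopt ↦ ⟨abs_maninConstant_eq_one_eightyFour W D hopt, not_two_dvd_maninConstant_eightyFour W D hopt⟩⟩

end Summit.BirchSwinnertonDyer.BirchSwinnertonDyer.Theorems.ManinLocalTwoThree.LevelEightyFour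

end
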